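import Literature.Analysis.FunctionSpaces.TorusRieszTransform
import Literature.Analysis.FunctionSpaces.TorusPeriodization
import Literature.Analysis.FluidPDE.HessianLaplacianLpProofs
import Literature.Analysis.FluidPDE.HessianLaplacianLpGeneralProofs
import Literature.Analysis.FluidPDE.ZerothLawProofs
import Mathlib.Analysis.Calculus.BumpFunction.InnerProduct
import Mathlib.MeasureTheory.Function.LpSeminorm.Indicator
import HarnessLib

/-!
# The Calderón–Zygmund Hessian bound on the flat torus from the whole-space bound

Analysis/FunctionSpaces proof file; sibling of `TorusRieszTransform` (the named fact
`Literature.Analysis.FunctionSpaces.Torus.eLpNorm_hessian_le_laplacian d`: Robinson–Rodrigo–Sadowski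
2016, App. B **Thm. B.7**, periodic case — for `1 < p < ∞` there is `C` with
`‖∂ⱼ∂ₖ w‖_{L^p(T^d)} ≤ C ‖Δw‖_{L^p(T^d)}` for all smooth real `w` on `T^d = ℝ^d/ℤ^d`).

This file PROVES

* `Torus.eLpNorm_hessian_le_laplacian_of_wholeSpace`: the torus fact in dimension `d` follows
  from the whole-space fact `Literature.Analysis.FluidPDE.stein1970_hessian_Lp_bound (EuclideanSpace ℝ d)`
  (Stein 1970, Ch. III §1.3 Prop. 3 = RRS Thm. B.5 (B.10): `‖∂ⱼ∂ₖ f‖_p ≤ c_p ‖Δf‖_p` for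
  `f ∈ C²_c(ℝⁿ)`), i.e. RRS's step "B.5/B.6 ⇒ B.7, periodic case";
* `Torus.eLpNorm_hessian_le_laplacian_holds_fin3 : eLpNorm_hessian_le_laplacian (Fin 3)`:
  the three-dimensional torus `𝕋³` — the case printed in RRS Thm. B.7 — UNCONDITIONALLY, since the
  whole-space bound on `ℝ³` is proved in the tree (`stein1970_hessian_Lp_bound_holds_fin3`,
  `FluidPDE/HessianLaplacianLpProofs`, by the Calderón–Zygmund `L^p` theory of
  `Literature/Analysis/SingularIntegrals/`).

* `Torus.eLpNorm_hessian_le_laplacian_holds : eLpNorm_hessian_le_laplacian d` for EVERY finite index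
  type `d` — the **discharge of the named fact** — from the whole-space bound in every dimension
  (`stein1970_hessian_Lp_bound_holds`, `FluidPDE/HessianLaplacianLpGeneralProofs`: the Calderón–Zygmund
  theory of the tree applied to the Riesz kernels of the heat semigroup, `∂ⱼ∂ₖ = -RⱼRₖΔ` realised through
  `-Δ⁻¹ = ∫₀^∞ e^{sΔ} ds`).

## The argument (localisation by a cut-off, then removal of the lower-order terms by integer scaling)

RRS (book p. 386) localise the periodic Green's function (`K = φ(x-y)/|x-y| + S`, Thm. C.5, only
sketched there). We localise the *function* instead, which needs no Green's function. Let
`W = w ∘ proj` be the `ℤ^d`-periodic lift of a smooth `w : T^d → ℝ`, `χ ∈ C^∞_c(ℝ^d)` a bump equal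
to `1` on a neighbourhood of the fundamental cube `[0,1)^d`, and `F = χW ∈ C^∞_c(ℝ^d)`.

1. `‖∂ⱼ∂ₖw‖_{L^p(T^d)} = ‖∂ⱼ∂ₖW‖_{L^p([0,1)^d)} = ‖∂ⱼ∂ₖF‖_{L^p([0,1)^d)} ≤ ‖∂ⱼ∂ₖF‖_{L^p(ℝ^d)} ≤ A‖ΔF‖_{L^p(ℝ^d)}`
   (the covering map is measure preserving on the cube, `F = W` near the cube, whole-space bound).
2. `ΔF = χΔW + WΔχ + 2∇χ·∇W` is supported in a ball `B` met by `N` lattice translates of the cube,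
   so `‖ΔF‖_p ≤ N^{1/p}(‖Δw‖_p + K₂‖w‖_p + 2K₁Σᵢ‖∂ᵢw‖_p)` with `K₁ = sup|∇χ|`, `K₂ = sup|Δχ|`:
   `‖∂ⱼ∂ₖw‖_p ≤ C₀‖Δw‖_p + C₁Σᵢ‖∂ᵢw‖_p + C₂‖w‖_p` with constants independent of `w`.
3. Integer dilations `x ↦ n•x` of `T^d` preserve Haar measure (tree: `measurePreserving_nsmul_unitAddTorus`)
   and periodicity (RRS p. 145, footnote 1), and `∂(w∘n) = n(∂w)∘n`; applying step 2 to `w∘n` and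
   dividing by `n²`, `‖∂ⱼ∂ₖw‖_p ≤ C₀‖Δw‖_p + (C₁Σᵢ‖∂ᵢw‖_p)/n + C₂‖w‖_p/n²` for every `n ≥ 1`, whence
   `‖∂ⱼ∂ₖw‖_p ≤ C₀‖Δw‖_p`.

## References

* J. C. Robinson, J. L. Rodrigo, W. Sadowski, *The Three-Dimensional Navier–Stokes Equations:
  Classical Theory*, CUP 2016: App. B, Thm. B.5 (B.10), Thm. B.6, **Thm. B.7** and the periodic
  case, book pp. 385–386; p. 145 footnote 1 (integer scalings preserve periodicity).
  [RobinsonRodrigoSadowskiCUP2016]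
* E. M. Stein, *Singular Integrals and Differentiability Properties of Functions*, Princeton
  1970: Ch. III §1.3, Prop. 3 (p. 59). [Stein1971]
* L. Grafakos, *Classical Fourier Analysis*, 3rd ed. (2014), §3.1.1 (functions on `𝕋ⁿ` as
  `1`-periodic functions on `ℝⁿ`, the fundamental cube). [Grafakos2014]
-/

noncomputable section

open MeasureTheory Set Filter Metric Function
open scoped ENNReal NNReal ContDiff Laplacian Topology

namespace Literature.Analysis.FunctionSpaces

namespace Torus

variable {d : Type*} [Fintype d]

/-! ### Integer dilations of the torus -/

section Dilation

omit [Fintype d] in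
/-- The covering map intertwines the real dilation `y ↦ n y` of `ℝ^d` with the integer dilation
`x ↦ n • x` of `T^d`. [folklore] -/
theorem proj_natCast_smul (n : ℕ) (y : EuclideanSpace ℝ d) : proj ((n : ℝ) • y) = n • proj y := by
  funext i
  rw [proj_smul_apply, Pi.smul_apply, proj_apply, ← nsmul_eq_mul, AddCircle.coe_nsmul]

omit [Fintype d] in
/-- The lift of `x ↦ w (n • x)` is `y ↦ (lift w) (n y)`. [folklore] -/
theorem lift_comp_nsmul {F : Type*} (w : UnitAddTorus d → F) (n : ℕ) :
    lift (fun x => w (n • x)) = fun y => lift w ((n : ℝ) • y) := by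
  funext y
  simp only [lift_apply, proj_natCast_smul]

variable {F : Type*} [NormedAddCommGroup F]

/-- `L^p` norms on the torus are invariant under the integer dilations `x ↦ n • x`, `n ≥ 1` (these
preserve Haar measure, `Literature.Analysis.FluidPDE.measurePreserving_nsmul_unitAddTorus`; RRS p. 145,
footnote 1: integer scalings preserve periodicity). [folklore] -/
theorem eLpNorm_comp_nsmul {f : UnitAddTorus d → F} (hf : AEStronglyMeasurable f volume) {n : ℕ}
    (hn : 0 < n) (p : ℝ≥0∞) : eLpNorm (fun x => f (n • x)) p volume = eLpNorm f p volume := by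
  classical
  exact eLpNorm_comp_measurePreserving hf
    (Literature.Analysis.FluidPDE.measurePreserving_nsmul_unitAddTorus hn)

variable [NormedSpace ℝ F] in
/-- `C^n` regularity is preserved by the integer dilations. [folklore] -/
theorem IsContDiff.comp_nsmul {n' : WithTop ℕ∞} {w : UnitAddTorus d → F} (hw : IsContDiff n' w)
    (n : ℕ) : IsContDiff n' (fun x => w (n • x)) := by
  have hw' : ContDiff ℝ n' (lift w) := hw
  show ContDiff ℝ n' (lift fun x => w (n • x))
  rw [lift_comp_nsmul]
  exact hw'.comp (contDiff_id.const_smul (n : ℝ))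

variable [NormedSpace ℝ F] in
/-- Smoothness is preserved by the integer dilations. [folklore] -/
theorem IsSmooth.comp_nsmul {w : UnitAddTorus d → F} (hw : IsSmooth w) (n : ℕ) :
    IsSmooth (fun x => w (n • x)) :=
  IsContDiff.comp_nsmul hw n

end Dilation

variable [DecidableEq d]

/-! ### Lifts of partial derivatives -/

/-- The lift of `∂ᵢ w` is the directional Fréchet derivative of the lift along `eᵢ`. [folklore] -/
theorem lift_partialDeriv {F : Type*} [NormedAddCommGroup F] [NormedSpace ℝ F]
    {w : UnitAddTorus d → F} (hw : IsContDiff 1 w) (i : d) :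
    lift (partialDeriv i w) = fun y => _root_.fderiv ℝ (lift w) y (EuclideanSpace.single i (1 : ℝ)) :=
  lift_lineDeriv hw (EuclideanSpace.single i (1 : ℝ))

/-- The lift of `∂ⱼ∂ₖ w` is the iterated directional derivative `∂_{eⱼ}(∂_{eₖ} W)` of the lift
`W`. [folklore] -/
theorem lift_partialDeriv_partialDeriv {w : UnitAddTorus d → ℝ} (hw : IsSmooth w) (j k : d) :
    lift (partialDeriv j (partialDeriv k w)) = fun y =>
      _root_.fderiv ℝ (fun z => _root_.fderiv ℝ (lift w) z (EuclideanSpace.single k (1 : ℝ))) y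
        (EuclideanSpace.single j (1 : ℝ)) := by
  rw [lift_partialDeriv ((hw.partialDeriv k).isContDiff (by decide)) j,
    lift_partialDeriv (hw.isContDiff (by decide)) k]

omit [Fintype d] in
/-- `∂ᵢ (c f) = c ∂ᵢ f` for real functions (no differentiability needed). [folklore] -/
theorem partialDeriv_const_mul (c : ℝ) (f : UnitAddTorus d → ℝ) (i : d) (x : UnitAddTorus d) :
    partialDeriv i (fun y => c * f y) x = c * partialDeriv i f x := by
  simp only [partialDeriv, lineDeriv, deriv_const_mul_field']

/-- **Chain rule for integer dilations:** `∂ᵢ (w ∘ n•)(x) = n (∂ᵢ w)(n • x)`. [folklore] -/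
theorem partialDeriv_comp_nsmul {w : UnitAddTorus d → ℝ} (hw : IsContDiff 1 w) (n : ℕ) (i : d)
    (x : UnitAddTorus d) :
    partialDeriv i (fun y => w (n • y)) x = (n : ℝ) * partialDeriv i w (n • x) := by
  obtain ⟨y, rfl⟩ := proj_surjective x
  have h1 := congrFun (lift_partialDeriv (hw.comp_nsmul n) i) y
  have h2 := congrFun (lift_partialDeriv hw i) ((n : ℝ) • y)
  rw [lift_apply] at h1 h2
  rw [proj_natCast_smul] at h2
  rw [h1, h2, lift_comp_nsmul]
  have hd : DifferentiableAt ℝ (lift w) ((n : ℝ) • y) :=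
    (ContDiff.differentiable hw one_ne_zero).differentiableAt
  have hs : HasFDerivAt (fun z : EuclideanSpace ℝ d => (n : ℝ) • z)
      ((n : ℝ) • ContinuousLinearMap.id ℝ (EuclideanSpace ℝ d)) y :=
    (hasFDerivAt_id y).const_smul (n : ℝ)
  have hc := hd.hasFDerivAt.comp y hs
  rw [show (fun z : EuclideanSpace ℝ d => lift w ((n : ℝ) • z)) =
      lift w ∘ fun z : EuclideanSpace ℝ d => (n : ℝ) • z from rfl, hc.fderiv]
  simp

/-- `∂ⱼ∂ₖ (w ∘ n•)(x) = n² (∂ⱼ∂ₖ w)(n • x)`. [folklore] -/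
theorem partialDeriv_partialDeriv_comp_nsmul {w : UnitAddTorus d → ℝ} (hw : IsSmooth w) (n : ℕ)
    (j k : d) (x : UnitAddTorus d) :
    partialDeriv j (partialDeriv k fun y => w (n • y)) x =
      (n : ℝ) ^ 2 * partialDeriv j (partialDeriv k w) (n • x) := by
  have h1 : partialDeriv k (fun y => w (n • y)) = fun x => (n : ℝ) * partialDeriv k w (n • x) :=
    funext fun x => partialDeriv_comp_nsmul (hw.isContDiff (by decide)) n k x
  rw [h1, partialDeriv_const_mul,
    partialDeriv_comp_nsmul ((hw.partialDeriv k).isContDiff (by decide)) n j x]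
  ring

/-- `Δ (w ∘ n•)(x) = n² (Δ w)(n • x)`. [folklore] -/
theorem laplacian_comp_nsmul {w : UnitAddTorus d → ℝ} (hw : IsSmooth w) (n : ℕ) (x : UnitAddTorus d) :
    laplacian (fun y => w (n • y)) x = (n : ℝ) ^ 2 * laplacian w (n • x) := by
  rw [laplacian_eq_sum_partialDeriv_partialDeriv (hw.comp_nsmul n),
    laplacian_eq_sum_partialDeriv_partialDeriv hw, Finset.mul_sum]
  exact Finset.sum_congr rfl fun i _ => partialDeriv_partialDeriv_comp_nsmul hw n i i x

/-! ### `L^p` norms of lifts -/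

omit [DecidableEq d] in
/-- `‖f‖_{L^p(T^d)} = ‖f ∘ proj‖_{L^p([0,1)^d)}` (the covering map is measure preserving on the
fundamental cube). [cite: Grafakos2014, §3.1.1] -/
theorem eLpNorm_eq_eLpNorm_lift_restrict {F : Type*} [NormedAddCommGroup F] {f : UnitAddTorus d → F}
    (hf : AEStronglyMeasurable f volume) (p : ℝ≥0∞) :
    eLpNorm f p volume = eLpNorm (lift f) p (volume.restrict (unitCube d)) :=
  (eLpNorm_comp_measurePreserving hf (measurePreserving_proj_unitCube_holds (d := d))).symm

/-- **Local `L^p` bound for lifts:** for a set `B ⊆ B̄(0, r)` and `n ≥ r + 1`,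
`‖f ∘ proj‖_{L^p(B)} ≤ N^{1/p} ‖f‖_{L^p(T^d)}` with `N` the number of lattice points in the window
of size `n` (cover `B` by `N` translates of the fundamental cube). [folklore] -/
theorem eLpNorm_lift_restrict_le {F : Type*} [NormedAddCommGroup F] {f : UnitAddTorus d → F}
    (hf : AEStronglyMeasurable f volume) {B : Set (EuclideanSpace ℝ d)} {r : ℝ}
    (hB : B ⊆ closedBall 0 r) {n : ℕ} (hn : r + 1 ≤ n) {p : ℝ≥0∞} (hp0 : p ≠ 0) (hp : p ≠ ⊤) :
    eLpNorm (lift f) p (volume.restrict B) ≤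
      ((latticeWindow d n).card : ℝ≥0∞) ^ (1 / p.toReal) * eLpNorm f p volume := by
  have hpr : 0 ≤ 1 / p.toReal := by positivity
  rw [eLpNorm_eq_lintegral_rpow_enorm_toReal hp0 hp, eLpNorm_eq_lintegral_rpow_enorm_toReal hp0 hp]
  have h := setLIntegral_lift_le (H := fun x => ‖f x‖ₑ ^ p.toReal)
    (hf.enorm.pow_const _) hB hn
  calc (∫⁻ y in B, ‖lift f y‖ₑ ^ p.toReal) ^ (1 / p.toReal)
      ≤ (((latticeWindow d n).card : ℝ≥0∞) * ∫⁻ x, ‖f x‖ₑ ^ p.toReal) ^ (1 / p.toReal) :=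
        ENNReal.rpow_le_rpow h hpr
    _ = ((latticeWindow d n).card : ℝ≥0∞) ^ (1 / p.toReal) *
          (∫⁻ x, ‖f x‖ₑ ^ p.toReal) ^ (1 / p.toReal) :=
        ENNReal.mul_rpow_of_nonneg _ _ hpr

/-- A function `φ` on `ℝ^d` bounded by `K` and vanishing off `B̄(0, r)`, multiplied by a lift:
`‖φ · (v ∘ proj)‖_{L^p(ℝ^d)} ≤ K N^{1/p} ‖v‖_{L^p(T^d)}`. [folklore] -/
theorem eLpNorm_mul_lift_le {φ : EuclideanSpace ℝ d → ℝ} {K r : ℝ} {n : ℕ} (hK : ∀ y, |φ y| ≤ K)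
    (hφ : ∀ y, r < ‖y‖ → φ y = 0) (hn : r + 1 ≤ n) {v : UnitAddTorus d → ℝ}
    (hv : AEStronglyMeasurable v volume) {p : ℝ≥0∞} (hp0 : p ≠ 0) (hp : p ≠ ⊤) :
    eLpNorm (fun y => φ y * lift v y) p volume ≤
      ENNReal.ofReal K * (((latticeWindow d n).card : ℝ≥0∞) ^ (1 / p.toReal) * eLpNorm v p volume) := by
  have hK0 : 0 ≤ K := (abs_nonneg _).trans (hK 0)
  have h1 : ∀ y, ‖φ y * lift v y‖ ≤ K * ‖(closedBall (0 : EuclideanSpace ℝ d) r).indicator (lift v) y‖ := by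
    intro y
    by_cases hy : y ∈ closedBall (0 : EuclideanSpace ℝ d) r
    · rw [indicator_of_mem hy, norm_mul, Real.norm_eq_abs]
      exact mul_le_mul_of_nonneg_right (hK y) (norm_nonneg _)
    · have hy' : r < ‖y‖ := by simpa [mem_closedBall_zero_iff] using hy
      rw [hφ y hy', zero_mul, norm_zero]
      positivity
  calc eLpNorm (fun y => φ y * lift v y) p volume
      ≤ ENNReal.ofReal K *
          eLpNorm ((closedBall (0 : EuclideanSpace ℝ d) r).indicator (lift v)) p volume :=
        eLpNorm_le_mul_eLpNorm_of_ae_le_mul (Eventually.of_forall h1) p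
    _ = ENNReal.ofReal K * eLpNorm (lift v) p (volume.restrict (closedBall 0 r)) := by
        rw [eLpNorm_indicator_eq_eLpNorm_restrict measurableSet_closedBall]
    _ ≤ ENNReal.ofReal K *
          (((latticeWindow d n).card : ℝ≥0∞) ^ (1 / p.toReal) * eLpNorm v p volume) := by
        gcongr
        exact eLpNorm_lift_restrict_le hv Subset.rfl hn hp0 hp

/-! ### Second derivatives of functions that agree on a ball -/

/-- If `F = W` on an open ball then their iterated directional derivatives agree there. [folklore] -/
theorem fderiv_fderiv_apply_eq_of_eqOn_ball {E : Type*} [NormedAddCommGroup E] [NormedSpace ℝ E]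
    {F W : E → ℝ} {c : E} {r : ℝ} (hFW : EqOn F W (ball c r)) {y : E} (hy : y ∈ ball c r)
    (a b : E) :
    _root_.fderiv ℝ (fun z => _root_.fderiv ℝ F z a) y b = _root_.fderiv ℝ (fun z => _root_.fderiv ℝ W z a) y b := by
  have h1 : ∀ z ∈ ball c r, _root_.fderiv ℝ F z = _root_.fderiv ℝ W z := fun z hz =>
    Filter.EventuallyEq.fderiv_eq (hFW.eventuallyEq_of_mem (isOpen_ball.mem_nhds hz))
  have h2 : (fun z => _root_.fderiv ℝ F z a) =ᶠ[𝓝 y] fun z => _root_.fderiv ℝ W z a :=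
    Filter.eventually_of_mem (isOpen_ball.mem_nhds hy) fun z hz => by
      show _root_.fderiv ℝ F z a = _root_.fderiv ℝ W z a
      rw [h1 z hz]
  rw [h2.fderiv_eq]

/-! ### Step 2: the localisation inequality -/

/-- **Localisation.** Given the whole-space bound `stein1970_hessian_Lp_bound (EuclideanSpace ℝ d)`
and `1 < p < ∞`, there are finite constants `C₀, C₁, C₂` such that for every smooth real `w` on
`T^d` and all `j, k`,
`‖∂ⱼ∂ₖw‖_p ≤ C₀‖Δw‖_p + C₁ Σᵢ ‖∂ᵢw‖_p + C₂‖w‖_p`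
(cut-off `χ(w ∘ proj)`, whole-space bound, `Δ(χW) = χΔW + WΔχ + 2∇χ·∇W`, and the local `L^p` bound
for lifts). [cite: RobinsonRodrigoSadowskiCUP2016, App. B Thm. B.7 (pp. 385–386)] -/
theorem exists_eLpNorm_hessian_le_add
    (h : Literature.Analysis.FluidPDE.stein1970_hessian_Lp_bound (EuclideanSpace ℝ d))
    {p : ℝ≥0∞} (hp1 : 1 < p) (hp : p < ⊤) :
    ∃ C₀ C₁ C₂ : ℝ≥0∞, C₀ ≠ ⊤ ∧ C₁ ≠ ⊤ ∧ C₂ ≠ ⊤ ∧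
      ∀ (w : UnitAddTorus d → ℝ), IsSmooth w → ∀ j k : d,
        eLpNorm (partialDeriv j (partialDeriv k w)) p volume ≤
          C₀ * eLpNorm (laplacian w) p volume +
            C₁ * ∑ i, eLpNorm (partialDeriv i w) p volume + C₂ * eLpNorm w p volume := by
  have hp0 : p ≠ 0 := (zero_lt_one.trans hp1).ne'
  have hpt : p ≠ ⊤ := hp.ne
  obtain ⟨A, hA⟩ := h p hp1 hp
  -- the cut-off
  set R : ℝ := Fintype.card d + 1 with hR
  have hR0 : 0 < R := by rw [hR]; positivity
  let χ : ContDiffBump (0 : EuclideanSpace ℝ d) := ⟨R, R + 1, hR0, by linarith⟩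
  have hχs : ContDiff ℝ ∞ (χ : EuclideanSpace ℝ d → ℝ) := χ.contDiff
  have hχ2 : ContDiff ℝ 2 (χ : EuclideanSpace ℝ d → ℝ) := χ.contDiff
  have hχ1 : ContDiff ℝ 1 (χ : EuclideanSpace ℝ d → ℝ) := χ.contDiff
  -- bounds for `∇χ` and `Δχ`
  obtain ⟨K₁, hK₁⟩ := (hχ1.continuous_fderiv one_ne_zero).bounded_above_of_compact_support
    (χ.hasCompactSupport.fderiv (𝕜 := ℝ))
  have hΔχc : Continuous (Δ (χ : EuclideanSpace ℝ d → ℝ)) :=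
    (Literature.Analysis.FluidPDE.contDiff_laplacian (n := 0) (χ.contDiff)).continuous
  have hΔχs : HasCompactSupport (Δ (χ : EuclideanSpace ℝ d → ℝ)) := by
    refine HasCompactSupport.intro χ.hasCompactSupport fun x hx => ?_
    exact notMem_support.1 fun hx' => hx (support_laplacian_subset _ hx')
  obtain ⟨K₂, hK₂⟩ := hΔχc.bounded_above_of_compact_support hΔχs
  -- vanishing off the ball of radius `R + 1`
  have hχ0 : ∀ y : EuclideanSpace ℝ d, R + 1 < ‖y‖ → χ y = 0 := fun y hy =>
    χ.zero_of_le_dist (by rw [dist_zero_right]; exact hy.le)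
  have hχ0' : ∀ y : EuclideanSpace ℝ d, R + 1 < ‖y‖ →
      (χ : EuclideanSpace ℝ d → ℝ) =ᶠ[𝓝 y] fun _ => 0 := by
    intro y hy
    have hopen : IsOpen {z : EuclideanSpace ℝ d | R + 1 < ‖z‖} := isOpen_lt continuous_const continuous_norm
    exact Filter.eventually_of_mem (hopen.mem_nhds hy) fun z hz => hχ0 z hz
  have hdχ0 : ∀ y : EuclideanSpace ℝ d, R + 1 < ‖y‖ → ∀ i : d,
      _root_.fderiv ℝ (χ : EuclideanSpace ℝ d → ℝ) y (EuclideanSpace.single i (1 : ℝ)) = 0 := by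
    intro y hy i
    rw [(hχ0' y hy).fderiv_eq]
    simp
  have hΔχ0 : ∀ y : EuclideanSpace ℝ d, R + 1 < ‖y‖ → Δ (χ : EuclideanSpace ℝ d → ℝ) y = 0 := by
    intro y hy
    rw [(InnerProductSpace.laplacian_congr_nhds (hχ0' y hy)).self_of_nhds,
      InnerProductSpace.laplacian_const, Pi.zero_apply]
  -- the lattice window covering the ball of radius `R + 1`
  obtain ⟨n, hn⟩ := exists_nat_ge (R + 1 + 1)
  set N : ℝ≥0∞ := ((latticeWindow d n).card : ℝ≥0∞) ^ (1 / p.toReal) with hN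
  have hNt : N ≠ ⊤ := ENNReal.rpow_ne_top_of_nonneg (by positivity) (ENNReal.natCast_ne_top _)
  -- pointwise bounds for the cut-off factors
  have hb₀ : ∀ y : EuclideanSpace ℝ d, |χ y| ≤ 1 := fun y => by
    rw [abs_of_nonneg χ.nonneg]; exact χ.le_one
  have hb₁ : ∀ (i : d) (y : EuclideanSpace ℝ d),
      |2 * _root_.fderiv ℝ (χ : EuclideanSpace ℝ d → ℝ) y (EuclideanSpace.single i (1 : ℝ))| ≤ 2 * K₁ := by
    intro i y
    rw [abs_mul, abs_two]
    refine mul_le_mul_of_nonneg_left ?_ zero_le_two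
    rw [← Real.norm_eq_abs]
    calc ‖_root_.fderiv ℝ (χ : EuclideanSpace ℝ d → ℝ) y (EuclideanSpace.single i (1 : ℝ))‖
        ≤ ‖_root_.fderiv ℝ (χ : EuclideanSpace ℝ d → ℝ) y‖ * ‖EuclideanSpace.single i (1 : ℝ)‖ :=
          ContinuousLinearMap.le_opNorm _ _
      _ ≤ K₁ * 1 := by
          gcongr
          · exact (norm_nonneg _).trans (hK₁ 0)
          · exact hK₁ y
          · rw [EuclideanSpace.single, PiLp.norm_single, norm_one]
      _ = K₁ := mul_one _
  have hb₂ : ∀ y : EuclideanSpace ℝ d, |Δ (χ : EuclideanSpace ℝ d → ℝ) y| ≤ K₂ := fun y => by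
    rw [← Real.norm_eq_abs]; exact hK₂ y
  refine ⟨A * N, A * (ENNReal.ofReal (2 * K₁) * N), A * (ENNReal.ofReal K₂ * N),
    ENNReal.mul_ne_top ENNReal.coe_ne_top hNt,
    ENNReal.mul_ne_top ENNReal.coe_ne_top (ENNReal.mul_ne_top ENNReal.ofReal_ne_top hNt),
    ENNReal.mul_ne_top ENNReal.coe_ne_top (ENNReal.mul_ne_top ENNReal.ofReal_ne_top hNt),
    fun w hw j k => ?_⟩
  -- the lift `lift w` and the localised function `G = χ · lift w`
  have hW : ContDiff ℝ ∞ (lift w) := hw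
  have hW2 : ContDiff ℝ 2 (lift w) := hW.of_le (by decide)
  set G : EuclideanSpace ℝ d → ℝ := fun y => χ y * lift w y with hG_def
  have hG2 : ContDiff ℝ 2 G := hχ2.mul hW2
  have hGc : HasCompactSupport G := by
    rw [hG_def]
    exact χ.hasCompactSupport.mul_right (f' := lift w)
  -- Step 1: the torus norm of `∂ⱼ∂ₖ w` is dominated by the whole-space norm of `∂ⱼ∂ₖ G`
  have hGW : EqOn G (lift w) (ball (0 : EuclideanSpace ℝ d) R) := fun z hz => by
    show χ z * lift w z = lift w z
    rw [χ.one_of_mem_closedBall (ball_subset_closedBall hz), one_mul]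
  have hcube : ∀ y ∈ unitCube d, lift (partialDeriv j (partialDeriv k w)) y =
      _root_.fderiv ℝ (fun z => _root_.fderiv ℝ G z (EuclideanSpace.single k (1 : ℝ))) y
        (EuclideanSpace.single j (1 : ℝ)) := by
    intro y hy
    have hyR : y ∈ ball (0 : EuclideanSpace ℝ d) R := by
      rw [mem_ball_zero_iff, hR]
      exact (norm_le_card_of_mem_unitCube hy).trans_lt (lt_add_one _)
    rw [lift_partialDeriv_partialDeriv hw j k, fderiv_fderiv_apply_eq_of_eqOn_ball hGW hyR]
  have hmeas2 : AEStronglyMeasurable (partialDeriv j (partialDeriv k w)) volume :=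
    ((hw.partialDeriv k).partialDeriv j).continuous.aestronglyMeasurable
  have step1 : eLpNorm (partialDeriv j (partialDeriv k w)) p volume ≤ A * eLpNorm (Δ G) p volume :=
    calc eLpNorm (partialDeriv j (partialDeriv k w)) p volume
        = eLpNorm (lift (partialDeriv j (partialDeriv k w))) p (volume.restrict (unitCube d)) :=
          eLpNorm_eq_eLpNorm_lift_restrict hmeas2 p
      _ = eLpNorm (fun y => _root_.fderiv ℝ (fun z => _root_.fderiv ℝ G z (EuclideanSpace.single k (1 : ℝ))) y
            (EuclideanSpace.single j (1 : ℝ))) p (volume.restrict (unitCube d)) :=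
          eLpNorm_congr_ae (ae_restrict_of_forall_mem measurableSet_unitCube hcube)
      _ ≤ eLpNorm (fun y => _root_.fderiv ℝ (fun z => _root_.fderiv ℝ G z (EuclideanSpace.single k (1 : ℝ))) y
            (EuclideanSpace.single j (1 : ℝ))) p volume :=
          eLpNorm_mono_measure _ Measure.restrict_le_self
      _ ≤ A * eLpNorm (Δ G) p volume :=
          hA G hG2 hGc _ _ (le_of_eq (by rw [EuclideanSpace.single, PiLp.norm_single, norm_one]))
            (le_of_eq (by rw [EuclideanSpace.single, PiLp.norm_single, norm_one]))
  -- Step 2: the Laplacian of the localised function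
  have hT₁ : ∀ y, (Δ (lift w)) y = lift (laplacian w) y := fun y => by
    rw [laplacian_lift, lift_apply]
  have hT₃ : ∀ (i : d) (y : EuclideanSpace ℝ d),
      _root_.fderiv ℝ (lift w) y (EuclideanSpace.single i (1 : ℝ)) = lift (partialDeriv i w) y :=
    fun i y => by rw [lift_partialDeriv (hw.isContDiff (by decide)) i]
  set T₁ : EuclideanSpace ℝ d → ℝ := fun y => χ y * lift (laplacian w) y with hT₁_def
  set T₂ : EuclideanSpace ℝ d → ℝ := fun y => (Δ (χ : EuclideanSpace ℝ d → ℝ)) y * lift w y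
    with hT₂_def
  set t : d → EuclideanSpace ℝ d → ℝ := fun i y =>
    (2 * _root_.fderiv ℝ (χ : EuclideanSpace ℝ d → ℝ) y (EuclideanSpace.single i (1 : ℝ))) *
      lift (partialDeriv i w) y with ht_def
  have hΔG : Δ G = (T₁ + T₂) + ∑ i, t i := by
    funext y
    rw [hG_def, Literature.Analysis.FluidPDE.laplacian_mul_eq (EuclideanSpace.basisFun d ℝ) hχ2 hW2 y,
      Pi.add_apply, Pi.add_apply, Finset.sum_apply, hT₁ y, Finset.mul_sum]
    have e3 : ∀ i, 2 * (_root_.fderiv ℝ (χ : EuclideanSpace ℝ d → ℝ) y (EuclideanSpace.basisFun d ℝ i) *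
        _root_.fderiv ℝ (lift w) y (EuclideanSpace.basisFun d ℝ i)) = t i y := fun i => by
      rw [ht_def, EuclideanSpace.basisFun_apply, hT₃ i y]
      ring
    rw [Finset.sum_congr rfl fun i _ => e3 i, hT₁_def, hT₂_def]
    ring
  -- measurability of the three pieces
  have hlc : ∀ {g : UnitAddTorus d → ℝ}, Continuous g → Continuous (lift g) := fun hg =>
    continuous_lift_iff.2 hg
  have hT₁m : AEStronglyMeasurable T₁ volume :=
    (χ.continuous.mul (hlc hw.laplacian.continuous)).aestronglyMeasurable
  have hT₂m : AEStronglyMeasurable T₂ volume := (hΔχc.mul (hlc hw.continuous)).aestronglyMeasurable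
  have htm : ∀ i, AEStronglyMeasurable (t i) volume := fun i =>
    ((continuous_const.mul (((hχ1.continuous_fderiv one_ne_zero).clm_apply
      continuous_const))).mul (hlc (hw.partialDeriv i).continuous)).aestronglyMeasurable
  -- the three bounds
  have e₁ : eLpNorm T₁ p volume ≤ ENNReal.ofReal 1 * (N * eLpNorm (laplacian w) p volume) :=
    eLpNorm_mul_lift_le hb₀ (fun y hy => hχ0 y hy) hn hw.laplacian.continuous.aestronglyMeasurable
      hp0 hpt
  have e₂ : eLpNorm T₂ p volume ≤ ENNReal.ofReal K₂ * (N * eLpNorm w p volume) :=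
    eLpNorm_mul_lift_le hb₂ (fun y hy => hΔχ0 y hy) hn hw.continuous.aestronglyMeasurable hp0 hpt
  have e₃ : ∀ i, eLpNorm (t i) p volume ≤
      ENNReal.ofReal (2 * K₁) * (N * eLpNorm (partialDeriv i w) p volume) := fun i =>
    eLpNorm_mul_lift_le (hb₁ i) (fun y hy => by rw [hdχ0 y hy i, mul_zero]) hn
      (hw.partialDeriv i).continuous.aestronglyMeasurable hp0 hpt
  have step2 : eLpNorm (Δ G) p volume ≤ N * eLpNorm (laplacian w) p volume +
      ENNReal.ofReal (2 * K₁) * N * ∑ i, eLpNorm (partialDeriv i w) p volume +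
        ENNReal.ofReal K₂ * N * eLpNorm w p volume := by
    rw [hΔG]
    calc eLpNorm ((T₁ + T₂) + ∑ i, t i) p volume
        ≤ eLpNorm (T₁ + T₂) p volume + eLpNorm (∑ i, t i) p volume :=
          eLpNorm_add_le (hT₁m.add hT₂m) (Finset.aestronglyMeasurable_sum _ fun i _ => htm i) hp1.le
      _ ≤ (eLpNorm T₁ p volume + eLpNorm T₂ p volume) + ∑ i, eLpNorm (t i) p volume := by
          gcongr
          · exact eLpNorm_add_le hT₁m hT₂m hp1.le
          · exact eLpNorm_sum_le (fun i _ => htm i) hp1.le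
      _ ≤ (ENNReal.ofReal 1 * (N * eLpNorm (laplacian w) p volume) +
            ENNReal.ofReal K₂ * (N * eLpNorm w p volume)) +
            ∑ i, ENNReal.ofReal (2 * K₁) * (N * eLpNorm (partialDeriv i w) p volume) := by
          exact add_le_add (add_le_add e₁ e₂) (Finset.sum_le_sum fun i _ => e₃ i)
      _ = N * eLpNorm (laplacian w) p volume +
          ENNReal.ofReal (2 * K₁) * N * ∑ i, eLpNorm (partialDeriv i w) p volume +
            ENNReal.ofReal K₂ * N * eLpNorm w p volume := by
          rw [ENNReal.ofReal_one, one_mul, ← Finset.mul_sum, ← Finset.mul_sum]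
          ring
  -- assembling
  calc eLpNorm (partialDeriv j (partialDeriv k w)) p volume ≤ A * eLpNorm (Δ G) p volume := step1
    _ ≤ A * (N * eLpNorm (laplacian w) p volume +
          ENNReal.ofReal (2 * K₁) * N * ∑ i, eLpNorm (partialDeriv i w) p volume +
            ENNReal.ofReal K₂ * N * eLpNorm w p volume) := by gcongr
    _ = A * N * eLpNorm (laplacian w) p volume +
          A * (ENNReal.ofReal (2 * K₁) * N) * ∑ i, eLpNorm (partialDeriv i w) p volume +
            A * (ENNReal.ofReal K₂ * N) * eLpNorm w p volume := by ring

/-! ### Step 3: removal of the lower-order terms by integer scaling -/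

/-- The arithmetic of the scaling step in `ℝ≥0∞`: from `a²D ≤ C₀a²L + C₁aS + C₂M` with
`1 ≤ a < ∞` one gets `D ≤ C₀L + (C₁S + C₂M)/a`. [folklore] -/
theorem le_add_div_of_sq_mul_le {D L S M C₀ C₁ C₂ a : ℝ≥0∞} (ha : 1 ≤ a) (ha' : a ≠ ⊤)
    (H : a ^ 2 * D ≤ C₀ * (a ^ 2 * L) + C₁ * (a * S) + C₂ * M) :
    D ≤ C₀ * L + (C₁ * S + C₂ * M) / a := by
  have ha0 : a ≠ 0 := (zero_lt_one.trans_le ha).ne'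
  have hinv : a⁻¹ * a = 1 := ENNReal.inv_mul_cancel ha0 ha'
  have hinv1 : a⁻¹ ≤ 1 := ENNReal.inv_le_one.2 ha
  calc D = a⁻¹ * a⁻¹ * (a ^ 2 * D) := by
        rw [show a⁻¹ * a⁻¹ * (a ^ 2 * D) = (a⁻¹ * a) * (a⁻¹ * a) * D by ring, hinv, one_mul, one_mul]
    _ ≤ a⁻¹ * a⁻¹ * (C₀ * (a ^ 2 * L) + C₁ * (a * S) + C₂ * M) := mul_le_mul' le_rfl H
    _ = C₀ * L + a⁻¹ * (C₁ * S) + a⁻¹ * a⁻¹ * (C₂ * M) := by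
        rw [show a⁻¹ * a⁻¹ * (C₀ * (a ^ 2 * L) + C₁ * (a * S) + C₂ * M) =
          (a⁻¹ * a) * (a⁻¹ * a) * (C₀ * L) + (a⁻¹ * a) * (a⁻¹ * (C₁ * S)) +
            a⁻¹ * a⁻¹ * (C₂ * M) by ring, hinv]
        ring
    _ ≤ C₀ * L + a⁻¹ * (C₁ * S) + a⁻¹ * (C₂ * M) := by
        gcongr
        calc a⁻¹ * a⁻¹ ≤ 1 * a⁻¹ := mul_le_mul' hinv1 le_rfl
          _ = a⁻¹ := one_mul _
    _ = C₀ * L + (C₁ * S + C₂ * M) / a := by rw [div_eq_mul_inv]; ring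

/-- **The torus bound from the whole-space bound** (RRS 2016, Thm. B.7, periodic case ⇐ Thm. B.5):
if `‖∂ₐ∂_b f‖_{L^p(ℝ^d)} ≤ A‖Δf‖_{L^p(ℝ^d)}` holds for `C²_c` functions on `ℝ^d = EuclideanSpace ℝ d`
(`stein1970_hessian_Lp_bound`), then for every `1 < p < ∞` there is `C` with
`‖∂ⱼ∂ₖ w‖_{L^p(T^d)} ≤ C ‖Δw‖_{L^p(T^d)}` for all smooth real `w` on the flat torus `T^d`
(localisation `exists_eLpNorm_hessian_le_add` applied to the dilates `w ∘ n•`, `n → ∞`).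
[cite: RobinsonRodrigoSadowskiCUP2016, App. B Thm. B.7 (pp. 385–386)] -/
theorem exists_eLpNorm_hessian_le_of_wholeSpace
    (h : Literature.Analysis.FluidPDE.stein1970_hessian_Lp_bound (EuclideanSpace ℝ d))
    {p : ℝ≥0∞} (hp1 : 1 < p) (hp : p < ⊤) :
    ∃ C : ℝ≥0, ∀ (w : UnitAddTorus d → ℝ), IsSmooth w → ∀ j k : d,
      eLpNorm (partialDeriv j (partialDeriv k w)) p volume ≤ C * eLpNorm (laplacian w) p volume := by
  obtain ⟨C₀, C₁, C₂, hC₀, hC₁, hC₂, hloc⟩ := exists_eLpNorm_hessian_le_add h hp1 hp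
  refine ⟨C₀.toNNReal, fun w hw j k => ?_⟩
  rw [ENNReal.coe_toNNReal hC₀]
  -- the four norms (all finite)
  set D := eLpNorm (partialDeriv j (partialDeriv k w)) p volume with hD
  set L := eLpNorm (laplacian w) p volume with hL
  set S := ∑ i, eLpNorm (partialDeriv i w) p volume with hS
  set M := eLpNorm w p volume with hM
  have hSt : S ≠ ⊤ := by
    rw [hS]
    exact ENNReal.sum_ne_top.2 fun i _ => ((hw.partialDeriv i).memLp p).eLpNorm_ne_top
  have hMt : M ≠ ⊤ := (hw.memLp p).eLpNorm_ne_top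
  set X := C₁ * S + C₂ * M with hX
  have hXt : X ≠ ⊤ := ENNReal.add_ne_top.2 ⟨ENNReal.mul_ne_top hC₁ hSt, ENNReal.mul_ne_top hC₂ hMt⟩
  -- the scaled inequality: `D ≤ C₀ L + X / n` for every `n ≥ 1`
  have hscale : ∀ n : ℕ, 0 < n → D ≤ C₀ * L + X / n := by
    intro n hn
    have hn1 : (1 : ℝ≥0∞) ≤ n := by exact_mod_cast hn
    have hwn : IsSmooth (fun x => w (n • x)) := hw.comp_nsmul n
    have H := hloc (fun x => w (n • x)) hwn j k
    -- rewrite the four norms of the dilate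
    have cn1 : ‖((n : ℝ) : ℝ)‖ₑ = (n : ℝ≥0∞) := by
      rw [Real.enorm_eq_ofReal_abs, abs_of_nonneg (by positivity), ENNReal.ofReal_natCast]
    have cn2 : ‖((n : ℝ) ^ 2 : ℝ)‖ₑ = (n : ℝ≥0∞) ^ 2 := by
      rw [Real.enorm_eq_ofReal_abs, abs_of_nonneg (by positivity), ENNReal.ofReal_pow (by positivity),
        ENNReal.ofReal_natCast]
    have r2 : eLpNorm (partialDeriv j (partialDeriv k fun y => w (n • y))) p volume =
        (n : ℝ≥0∞) ^ 2 * D := by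
      have : partialDeriv j (partialDeriv k fun y => w (n • y)) =
          ((n : ℝ) ^ 2) • fun x => partialDeriv j (partialDeriv k w) (n • x) :=
        funext fun x => by rw [partialDeriv_partialDeriv_comp_nsmul hw n j k x]; rfl
      rw [this, eLpNorm_const_smul, cn2, hD,
        eLpNorm_comp_nsmul ((hw.partialDeriv k).partialDeriv j).continuous.aestronglyMeasurable hn]
    have rL : eLpNorm (laplacian fun y => w (n • y)) p volume = (n : ℝ≥0∞) ^ 2 * L := by
      have : laplacian (fun y => w (n • y)) = ((n : ℝ) ^ 2) • fun x => laplacian w (n • x) :=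
        funext fun x => by rw [laplacian_comp_nsmul hw n x]; rfl
      rw [this, eLpNorm_const_smul, cn2, hL,
        eLpNorm_comp_nsmul hw.laplacian.continuous.aestronglyMeasurable hn]
    have r1 : ∀ i, eLpNorm (partialDeriv i fun y => w (n • y)) p volume =
        (n : ℝ≥0∞) * eLpNorm (partialDeriv i w) p volume := fun i => by
      have : partialDeriv i (fun y => w (n • y)) = (n : ℝ) • fun x => partialDeriv i w (n • x) :=
        funext fun x => by rw [partialDeriv_comp_nsmul (hw.isContDiff (by decide)) n i x]; rfl
      rw [this, eLpNorm_const_smul, cn1,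
        eLpNorm_comp_nsmul (hw.partialDeriv i).continuous.aestronglyMeasurable hn]
    have r0 : eLpNorm (fun y => w (n • y)) p volume = M :=
      eLpNorm_comp_nsmul hw.continuous.aestronglyMeasurable hn p
    rw [r2, rL, r0] at H
    simp_rw [r1, ← Finset.mul_sum] at H
    rw [← hS] at H
    exact le_add_div_of_sq_mul_le hn1 (ENNReal.natCast_ne_top n) H
  -- let `n → ∞`
  refine ENNReal.le_of_forall_pos_le_add fun ε hε _ => ?_
  have hε0 : (ε : ℝ≥0∞) ≠ 0 := by exact_mod_cast hε.ne'
  obtain ⟨n, hn⟩ := ENNReal.exists_nat_gt (ENNReal.div_ne_top hXt hε0)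
  have hn0 : 0 < n := by
    rcases Nat.eq_zero_or_pos n with h0 | h0
    · subst h0
      simp at hn
    · exact h0
  have hXn : X / n ≤ ε := by
    rw [ENNReal.div_le_iff (by exact_mod_cast hn0.ne') (ENNReal.natCast_ne_top n)]
    have := (ENNReal.div_lt_iff (Or.inl hε0) (Or.inl ENNReal.coe_ne_top)).1 hn
    rw [mul_comm] at this
    exact this.le
  exact (hscale n hn0).trans (add_le_add le_rfl hXn)

end Torus

/-! ### The named fact on `T^d` from the whole-space fact on `ℝ^d`; the case `𝕋³` unconditionally -/

namespace Torus

/-- **RRS 2016, Thm. B.7 (periodic case) from Thm. B.5:** the whole-space Calderón–Zygmund bound for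
the Hessian on `ℝ^d` (`Literature.Analysis.FluidPDE.stein1970_hessian_Lp_bound (EuclideanSpace ℝ d)`,
Stein 1970, III §1.3 Prop. 3) implies the named fact `Torus.eLpNorm_hessian_le_laplacian d` on the
flat torus `T^d`. [cite: RobinsonRodrigoSadowskiCUP2016, App. B Thm. B.7 (pp. 385–386)] -/
theorem eLpNorm_hessian_le_laplacian_of_wholeSpace {d : Type*} [Fintype d]
    (h : Literature.Analysis.FluidPDE.stein1970_hessian_Lp_bound (EuclideanSpace ℝ d)) :
    eLpNorm_hessian_le_laplacian d := by
  intro _ p hp1 hp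
  exact exists_eLpNorm_hessian_le_of_wholeSpace h hp1 hp

/-- **The Calderón–Zygmund Hessian bound on the three-dimensional torus `𝕋³`, proved** — the case
of RRS 2016, Thm. B.7 as printed (`Ω = 𝕋³`): for every `1 < p < ∞` there is `C` with
`‖∂ⱼ∂ₖ w‖_{L^p(𝕋³)} ≤ C ‖Δw‖_{L^p(𝕋³)}` for all smooth real `w` (whole-space bound on `ℝ³`,
`stein1970_hessian_Lp_bound_holds_fin3`, by the Calderón–Zygmund theory of
`Literature/Analysis/SingularIntegrals/`, and `eLpNorm_hessian_le_laplacian_of_wholeSpace`).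
[cite: RobinsonRodrigoSadowskiCUP2016, App. B Thm. B.7 (pp. 385–386)] -/
theorem eLpNorm_hessian_le_laplacian_holds_fin3 : eLpNorm_hessian_le_laplacian (Fin 3) :=
  eLpNorm_hessian_le_laplacian_of_wholeSpace
    Literature.Analysis.FluidPDE.stein1970_hessian_Lp_bound_holds_fin3

/-- **Discharge of the named fact `Torus.eLpNorm_hessian_le_laplacian d` for every finite index type
`d`** (Robinson–Rodrigo–Sadowski 2016, App. B Thm. B.7, periodic case; recorded on `T^d`): for every
`1 < p < ∞` there is `C` with `‖∂ⱼ∂ₖ w‖_{L^p(T^d)} ≤ C ‖Δw‖_{L^p(T^d)}` for all smooth real `w` on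
the flat torus. PROVED: the whole-space Calderón–Zygmund bound in dimension `d`
(`Literature.Analysis.FluidPDE.stein1970_hessian_Lp_bound_holds`, Stein 1970 III §1.3 Prop. 3 = RRS
Thm. B.5, via the tree's Calderón–Zygmund `L^p` theory and the Riesz kernels of the heat semigroup)
and the localisation-plus-scaling reduction `eLpNorm_hessian_le_laplacian_of_wholeSpace`.
[cite: RobinsonRodrigoSadowskiCUP2016, App. B Thm. B.7 (pp. 385–386)] -/
theorem eLpNorm_hessian_le_laplacian_holds {d : Type*} [Fintype d] : eLpNorm_hessian_le_laplacian d :=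
  eLpNorm_hessian_le_laplacian_of_wholeSpace
    Literature.Analysis.FluidPDE.stein1970_hessian_Lp_bound_holds

end Torus

end Literature.Analysis.FunctionSpaces
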